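import Mathlib.Algebra.BigOperators.Group.Finset.Basic
import Mathlib.Algebra.Ring.Parity
import Mathlib.Algebra.BigOperators.Ring.Finset
import Mathlib.Algebra.Group.Int.Even
import Mathlib.Tactic.Ring
import Mathlib.Tactic.Linarith
import HarnessLib

/-!
# Venture HSemireg — signed counts of odd net multiplicity never vanish

Elementary parity bookkeeping behind the «parity form» of the TWIN SUPERTRACE lemma of the
computation cell `pub-hsemireg` (seat w1-tw-2, `widen/W1/LOOPDEG-X2-tw2.md` §10.1 PRECISION):
if copies of one letter sit in degrees `d` with counts `n d`, and a cancellation argument leaves a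
weighted sum `∑ c d * n d` with *unknown* signs `c d = ±1`, then that sum is congruent modulo 2
to any other `±1`-weighted sum of the same counts — in particular to the net multiplicity
`∑ (-1)^d * n d` — so it cannot vanish when the net multiplicity is odd.

* `even_sum_sub_sum_of_signs` — two `±1`-weighted sums of the same natural counts differ by an
  even integer;
* `odd_sum_of_signs` — hence one is odd iff the other is;
* `sum_signs_ne_zero_of_odd` — **an odd `±1`-weighted count is never zero**, whatever the signs.

HONEST FRAMING. Finite sums of integers only; the Lean index of one bookkeeping step of a
NECESSARY-condition sieve used by the cell. No sheaf, complex, abelian variety or semiregularity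
map appears; nothing here says that HC, HC_CM or HC_AV holds, and nothing here is a new case of
anything.
-/

namespace Summit.Ventures.HSemireg

namespace SignedCount

variable {ι : Type*}

/-- Two `±1`-weighted sums of the same natural-number counts differ by an EVEN integer
(termwise `(c i - ε i) * n i` with `c i - ε i ∈ {0, 2, -2}`). -/
theorem even_sum_sub_sum_of_signs (s : Finset ι) (n : ι → ℕ) (c ε : ι → ℤ)
    (hc : ∀ i ∈ s, c i = 1 ∨ c i = -1) (hε : ∀ i ∈ s, ε i = 1 ∨ ε i = -1) :
    Even (∑ i ∈ s, c i * (n i : ℤ) - ∑ i ∈ s, ε i * (n i : ℤ)) := by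
  rw [← Finset.sum_sub_distrib, even_iff_two_dvd]
  refine Finset.dvd_sum fun i hi => ?_
  rw [← sub_mul]
  have h2 : (2 : ℤ) ∣ (c i - ε i) := by
    rcases hc i hi with h | h <;> rcases hε i hi with h' | h' <;>
      · rw [h, h']
        decide
  exact h2.mul_right _

/-- If one `±1`-weighted sum of the counts is odd, so is every other. -/
theorem odd_sum_of_signs (s : Finset ι) (n : ι → ℕ) (c ε : ι → ℤ)
    (hc : ∀ i ∈ s, c i = 1 ∨ c i = -1) (hε : ∀ i ∈ s, ε i = 1 ∨ ε i = -1)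
    (hodd : Odd (∑ i ∈ s, ε i * (n i : ℤ))) :
    Odd (∑ i ∈ s, c i * (n i : ℤ)) := by
  have hev := even_sum_sub_sum_of_signs s n c ε hc hε
  have key : ∑ i ∈ s, c i * (n i : ℤ)
      = (∑ i ∈ s, c i * (n i : ℤ) - ∑ i ∈ s, ε i * (n i : ℤ)) + ∑ i ∈ s, ε i * (n i : ℤ) := by
    ring
  rw [key]
  exact hev.add_odd hodd

/-- **TWIN SUPERTRACE, parity form.** An odd `±1`-weighted count is never zero: if some
`±1`-weighting `ε` of the counts `n` (e.g. `ε d = (-1)^d`, the NET multiplicity of a letter)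
has odd sum, then EVERY `±1`-weighting `c` has non-zero sum. -/
theorem sum_signs_ne_zero_of_odd (s : Finset ι) (n : ι → ℕ) (c ε : ι → ℤ)
    (hc : ∀ i ∈ s, c i = 1 ∨ c i = -1) (hε : ∀ i ∈ s, ε i = 1 ∨ ε i = -1)
    (hodd : Odd (∑ i ∈ s, ε i * (n i : ℤ))) :
    ∑ i ∈ s, c i * (n i : ℤ) ≠ 0 := by
  intro h0
  have hO := odd_sum_of_signs s n c ε hc hε hodd
  rw [h0] at hO
  exact (Int.not_odd_iff_even.mpr (by decide)) hO

/-- The net-multiplicity instance: with `ε d = (-1)^d` on a finite set of degrees, an odd net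
multiplicity `∑ (-1)^d * n d` forces every `±1`-weighted count `∑ c d * n d` to be non-zero. -/
theorem sum_signs_ne_zero_of_odd_net (s : Finset ℤ) (n : ℤ → ℕ) (c : ℤ → ℤ)
    (hc : ∀ d ∈ s, c d = 1 ∨ c d = -1)
    (hodd : Odd (∑ d ∈ s, (-1 : ℤ) ^ (d.natAbs) * (n d : ℤ))) :
    ∑ d ∈ s, c d * (n d : ℤ) ≠ 0 :=
  sum_signs_ne_zero_of_odd s n c (fun d => (-1 : ℤ) ^ d.natAbs) hc
    (fun d _ => by
      rcases Nat.even_or_odd d.natAbs with h | h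
      · exact Or.inl h.neg_one_pow
      · exact Or.inr h.neg_one_pow) hodd

end SignedCount

end Summit.Ventures.HSemireg
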